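import Summits.HodgeConjecture.HodgeConjecture.Theorems.R90S6EtaTwoPartnerOnBasis       -- ★ W10-j FILE B (p02): (J.0) line values, (J.1)–(J.3); brings ★ FILE A, ★ η̂ (E.5) pt 2
import Summits.HodgeConjecture.HodgeConjecture.Theorems.R90S6MacdonaldClosedFormU2      -- ★ F2′-U2 (p03): closed form of `𝒮(φ′_m)`, ball formula
import HarnessLib

/-!
# R90 · S6 «Ch. 14.1–14.5 stable TF» — WAVE 10 card W10-j, FILE C: THE CLOSED FORM OF `E_a = η̂(c_{(a,0)})` IN THE CARTAN BASIS OF `ℋ(U(J₀,2)(E_w), K₀)`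
# (`Theorems/R90S6EtaTwoPartnerClosedForm.lean`; row E1.4.4.3.2 — the coefficients the count side reads)

Cell `hodgecm-mathlib`, crux H413 (`stmt-HodgeConjecture-24833`), route of record `HCCMUnconditional`; programme R90-TF, section S6 (base `R90-C14`),
seat R90-C14-p02 (g2); S6 dealer R90-C14-plan (g2) CARD W10-j (J.4) (R90 bus 2026-09-05T01:37:25Z ∕ 01:46Z «prove it by the eigenvalue-induction +
★ `eq_etaGraphTwoPartnerAlgHom_of_graph` road»).  Lane `--supports stmt-HodgeConjecture-24833 --as helper`; THEOREMS ONLY; letters = ★ FILE B.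

THE BALLS.  `B_i := Σ_{j ≤ i} φ′_j = 1_{K₀ t^{≤ i} K₀}` (the ball of radius `i` in the `(q+1)`-regular tree; the SAME element as in ★ (I.3) `signInvolutionAlgHom_basic_pow`),
`𝒮(B_i) = q^i V_i`, `V_i = Σ_{|j| ≤ i} x^{ℓ_j}` (★ ball formula `sum_satakeTransform_doubleCosetOperator_pow_two`).

CONTENT (`E_a = η̂ c_{(a,0)}`, `a ≥ 1`, `q = √Q = Nat.sqrt #𝓀[E_w]`, junction pin `huq : u = q` as in FILE B):
* (J.4) **`etaGraphTwoPartnerAlgHom_zpowDiagGL_pair_zero`** — THE CLOSED FORM (ball form):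
  **`E_a = φ′_a − (q − 1) • B_{a−1} + (q² − 1) Σ_{i < a−1} (−1)^{a+i} q^{a−2−i} • B_i`**
  (`E₁ = φ′₁ − (q−1)`; `E₂ = φ′₂ − (q−1)B₁ + (q²−1)B₀ = φ′₂ − (q−1)φ′₁ + (q²−q)`; `E₃ = φ′₃ − (q−1)B₂ + (q²−1)B₁ − (q²−1)q B₀`).
* (J.4′) **`etaGraphTwoPartnerAlgHom_zpowDiagGL_pair_zero_shell`** — THE SHELL FORM `E_a = φ′_a + Σ_{j<a} e_{a,j} • φ′_j`,
  **`e_{a,j} = −(q−1) + (q²−1) Σ_{i ∈ [j, a−1)} (−1)^{a+i} q^{a−2−i}`** — the coefficients E1.4.4.3.2's count side reads.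
PROOF (eigenvalue induction, no algebra on the Hecke carriers): with `s = z + z⁻¹`, `P_a = z^a + z^{−a}`, `A_n = Σ_{i<n} (−1)^{n+1+i} V_i(z)` (`A_{n+1} = V_n − A_n`,
`s·A_{n+1} = A_{n+2} + A_n`), the `U(2)` eigenvalue of the right side is `y_a = q^a P_a + (q²−1) q^{a−2} A_{a−1}` (★ F2′-U2 through `ev_{(z,1)} ∘ 𝒮`; the `B_{a−1}` term cancels
the ball part of `𝒮(φ′_a)`), and `y` obeys `y_{a+1} = q s·y_a − N_a y_{a−1}` (`N₁ = Q+1`, `N_a = Q`), `y₀ = 1`, `y₁ = q s` — the SAME two-step recursion as the `GL₂` eigenvalues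
`x_a = λ^{wt}_{(z,z⁻¹)}(c_{(a,0)})` (★ FILE A Pieri through `λ^{wt}`, ★ (J.0)); hence `x_a = y_a`, and ★ `eq_etaGraphTwoPartnerAlgHom_of_graph` closes.
HONEST LABEL: local Hecke bookkeeping; proves no orbital-integral identity and no printed global statement; count-neutral until E1.4.4.3.2 consumes it.  HC_CM is proved
only modulo the 7 printed citations (2 remaining named inputs: hLiu418 = stmt-HodgeConjecture-24832, h413 = stmt-HodgeConjecture-24833) until rung 0 closes; REL ≠ ★ ≠ BUILT.

## References
* [Rogawski1990] J. D. Rogawski, *Automorphic Representations of Unitary Groups in Three Variables*, Ann. of Math. Stud. 123 (1990), §4.11 Prop. 4.11.1 p. 58.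
* [Macdonald1971] I. G. Macdonald, *Spherical functions on a group of p-adic type* (1971), Ch. V §3 (rank one: `GL₂` and the `(q+1)`-regular tree).
* [ShimuraIATAF1971] G. Shimura, *Introduction to the arithmetic theory of automorphic functions* (1971), Thm. 3.21, Thm. 3.24.
* [CartierCorvallis1979] P. Cartier, *Representations of 𝔭-adic groups: a survey*, PSPM 33.1 (1979), §IV (4.2), Thm. 4.1, Cor. 4.2.
-/

set_option autoImplicit false
-- the mandated namespace repeats the single-problem summit's segment (`HodgeConjecture.HodgeConjecture`)
set_option linter.dupNamespace false

noncomputable section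

open NumberField IsDedekindDomain
open Literature.NumberTheory.Automorphic Literature.NumberTheory.Automorphic.HermitianLattice Literature.NumberTheory.Automorphic.UnitaryGroup
open Literature.NumberTheory.Automorphic.CartanUnique
open scoped MatrixGroups
open ValuativeRel Finset

namespace Summit.HodgeConjecture.HodgeConjecture.R90.S6

universe u

/-! ## §0 Light-carrier bookkeeping -/

/-- `f (x + a • y + Σ_i c_i • w_i) = f x + a • f y + Σ_i c_i • f (w_i)`. [folklore] -/
private theorem algHom_apply_add_smul_add_sum_smul {R A B ι : Type*} [CommSemiring R] [Semiring A] [Semiring B] [Algebra R A] [Algebra R B]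
    (f : A →ₐ[R] B) (x : A) (a : R) (y : A) (s : Finset ι) (c : ι → R) (w : ι → A) :
    f (x + a • y + ∑ i ∈ s, c i • w i) = f x + a • f y + ∑ i ∈ s, c i • f (w i) := by
  simp only [map_add, map_smul, map_sum]

/-- `f (Σ_i y_i) = Σ_i f (y_i)`. [folklore] -/
private theorem algHom_apply_sum' {R A B ι : Type*} [CommSemiring R] [Semiring A] [Semiring B] [Algebra R A] [Algebra R B]
    (f : A →ₐ[R] B) (s : Finset ι) (y : ι → A) : f (∑ i ∈ s, y i) = ∑ i ∈ s, f (y i) :=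
  map_sum f y s

/-- `f x · f y = f z + b • f v` from `x · y = z + b • v`. [folklore] -/
private theorem algHom_mul_of_eq_add_smul' {R A B : Type*} [CommSemiring R] [Semiring A] [Semiring B] [Algebra R A] [Algebra R B]
    (f : A →ₐ[R] B) {x y z v : A} {b : R} (h : x * y = z + b • v) : f x * f y = f z + b • f v := by
  rw [← map_mul, h, map_add, map_smul]

/-- `f x = f z` from `x = y · z` and `f y = 1`. [folklore] -/
private theorem algHom_apply_eq_of_eq_mul_of_map_eq_one' {R A B : Type*} [CommSemiring R] [Semiring A] [Semiring B] [Algebra R A] [Algebra R B]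
    (f : A →ₐ[R] B) {x y z : A} (h : x = y * z) (hy : f y = 1) : f x = f z := by
  rw [h, map_mul, hy, one_mul]

/-! ## §1 Scalar sequences: Chebyshev transfer to the alternating balls and the two-step recursion -/

/-- **Chebyshev for the alternating balls**: if `A₀ = 0`, `A_{n+1} = V_n − A_n`, `s V_{n+1} = V_{n+2} + V_n`, `s V₀ = V₁ − V₀`, then `s A_{n+1} = A_{n+2} + A_n`.
[cite: Macdonald1971, Ch. V §3] -/
private theorem cheb_alt (s : ℂ) (V A : ℕ → ℂ) (hA0 : A 0 = 0) (hA : ∀ n, A (n + 1) = V n - A n) (hV : ∀ n, s * V (n + 1) = V (n + 2) + V n)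
    (hV0 : s * V 0 = V 1 - V 0) (n : ℕ) : s * A (n + 1) = A (n + 2) + A n := by
  induction n with
  | zero =>
    have h0 : A 1 = V 0 - A 0 := hA 0
    have h1 : A 2 = V 1 - A 1 := hA 1
    show s * A 1 = A 2 + A 0
    linear_combination (s + 1) * h0 - h1 + hV0 - (s + 2) * hA0
  | succ n ih =>
    have h0 : A (n + 1) = V n - A n := hA n
    have h1 : A (n + 2) = V (n + 1) - A (n + 1) := hA (n + 1)
    have h2 : A (n + 3) = V (n + 2) - A (n + 2) := hA (n + 2)
    have hv : s * V (n + 1) = V (n + 2) + V n := hV n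
    show s * A (n + 2) = A (n + 3) + A (n + 1)
    linear_combination s * h1 - h2 + hv - ih - h0

/-- **The closed form obeys the `GL₂` recursion, first step**: `y₂ = q s·y₁ − (q²+1)·y₀` with `y₀ = 1`, `y₁ = q P₁`, `y₂ = q² P₂ + (q²−1) A₁` (`s P₁ = P₂ + P₀`, `P₀ = 2`,
`P₁ = s`, `A₁ = 1`). [cite: Macdonald1971, Ch. V §3] -/
private theorem closedForm_rec_one (s q : ℂ) (P A : ℕ → ℂ) (hP : ∀ a, s * P (a + 1) = P (a + 2) + P a) (hP0 : P 0 = 2) (hP1 : P 1 = s)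
    (hA1 : A 1 = 1) : q ^ 2 * P 2 + (q ^ 2 - 1) * A 1 = q * s * (q * P 1) - (q ^ 2 + 1) * 1 := by
  have e : s * P 1 = P 2 + P 0 := hP 0
  rw [hA1, hP1]
  rw [hP1, hP0] at e
  linear_combination (-q ^ 2) * e

/-- **The closed form obeys the `GL₂` recursion, second step**: `y₃ = q s·y₂ − q²·y₁` (`A₀ = 0`). [cite: Macdonald1971, Ch. V §3] -/
private theorem closedForm_rec_two (s q : ℂ) (P A : ℕ → ℂ) (hP : ∀ a, s * P (a + 1) = P (a + 2) + P a) (hA0 : A 0 = 0)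
    (hA : ∀ n, s * A (n + 1) = A (n + 2) + A n) :
    q ^ 3 * P 3 + (q ^ 2 - 1) * q ^ 1 * A 2 = q * s * (q ^ 2 * P 2 + (q ^ 2 - 1) * q ^ 0 * A 1) - q ^ 2 * (q * P 1) := by
  have eP : s * P 2 = P 3 + P 1 := hP 1
  have eA : s * A 1 = A 2 + A 0 := hA 0
  rw [hA0] at eA
  linear_combination (-q ^ 3) * eP - (q ^ 2 - 1) * q * eA

/-- **The closed form obeys the `GL₂` recursion, general step**: `y_{k+4} = q s·y_{k+3} − q²·y_{k+2}`. [cite: Macdonald1971, Ch. V §3] -/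
private theorem closedForm_rec_succ (s q : ℂ) (P A : ℕ → ℂ) (hP : ∀ a, s * P (a + 1) = P (a + 2) + P a) (hA : ∀ n, s * A (n + 1) = A (n + 2) + A n)
    (k : ℕ) :
    q ^ (k + 4) * P (k + 4) + (q ^ 2 - 1) * q ^ (k + 2) * A (k + 3) =
      q * s * (q ^ (k + 3) * P (k + 3) + (q ^ 2 - 1) * q ^ (k + 1) * A (k + 2)) - q ^ 2 * (q ^ (k + 2) * P (k + 2) + (q ^ 2 - 1) * q ^ k * A (k + 1)) := by
  have eP : s * P (k + 3) = P (k + 4) + P (k + 2) := hP (k + 2)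
  have eA : s * A (k + 2) = A (k + 3) + A (k + 1) := hA (k + 1)
  linear_combination (-(q ^ (k + 4))) * eP - (q ^ 2 - 1) * q ^ (k + 2) * eA

/-- **Two-step recursions with the same data agree.** [folklore] -/
private theorem etaTwo_twoStepRec_unique (x y : ℕ → ℂ) (c d : ℕ → ℂ) (h0 : x 0 = y 0) (h1 : x 1 = y 1)
    (hx : ∀ a, x (a + 2) = c a * x (a + 1) - d a * x a) (hy : ∀ a, y (a + 2) = c a * y (a + 1) - d a * y a) (n : ℕ) : x n = y n := by
  induction n using Nat.strong_induction_on with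
  | _ n ih =>
    rcases n with _ | n
    · exact h0
    rcases n with _ | n
    · exact h1
    rw [hx, hy, ih n (by omega), ih (n + 1) (by omega)]

/-! ## §2 The scalar letters at `z`: `s = z + z⁻¹`, `P_a = z^a + z^{−a}`, `V_n`, `A_n` -/

/-- `s P_{a+1} = P_{a+2} + P_a`. [folklore] -/
private theorem orbit_cheb (z : ℂˣ) (a : ℕ) :
    ((z : ℂ) + (z : ℂ)⁻¹) * ((z : ℂ) ^ (a + 1) + (z : ℂ)⁻¹ ^ (a + 1)) = ((z : ℂ) ^ (a + 2) + (z : ℂ)⁻¹ ^ (a + 2)) + ((z : ℂ) ^ a + (z : ℂ)⁻¹ ^ a) := by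
  have hz : (z : ℂ) * (z : ℂ)⁻¹ = 1 := mul_inv_cancel₀ z.ne_zero
  linear_combination ((z : ℂ) ^ a + (z : ℂ)⁻¹ ^ a) * hz

/-- `s V_{n+1} = V_{n+2} + V_n` for the balls `V_n = 1 + Σ_{k<n} (z^{k+1} + z^{−(k+1)})`. [cite: Macdonald1971, Ch. V §3] -/
private theorem ball_cheb (z : ℂˣ) (n : ℕ) :
    ((z : ℂ) + (z : ℂ)⁻¹) * (1 + ∑ k ∈ range (n + 1), ((z : ℂ) ^ (k + 1) + (z : ℂ)⁻¹ ^ (k + 1))) =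
      (1 + ∑ k ∈ range (n + 2), ((z : ℂ) ^ (k + 1) + (z : ℂ)⁻¹ ^ (k + 1))) + (1 + ∑ k ∈ range n, ((z : ℂ) ^ (k + 1) + (z : ℂ)⁻¹ ^ (k + 1))) := by
  induction n with
  | zero =>
    have hz : (z : ℂ) * (z : ℂ)⁻¹ = 1 := mul_inv_cancel₀ z.ne_zero
    simp only [Finset.sum_range_succ, Finset.sum_range_zero, zero_add, pow_one]
    linear_combination (2 : ℂ) * hz
  | succ n ih =>
    rw [Finset.sum_range_succ _ (n + 1), ← add_assoc, mul_add, ih, Finset.sum_range_succ _ (n + 2), Finset.sum_range_succ _ n, orbit_cheb z (n + 1)]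
    ring

/-- `A_{n+1} = V_n − A_n` for `A_n = Σ_{i<n} (−1)^{n+1+i} V_i`. [folklore] -/
private theorem alt_succ (V : ℕ → ℂ) (n : ℕ) :
    (∑ i ∈ range (n + 1), (-1 : ℂ) ^ (n + 1 + 1 + i) * V i) = V n - ∑ i ∈ range n, (-1 : ℂ) ^ (n + 1 + i) * V i := by
  rw [Finset.sum_range_succ, show ((-1 : ℂ) ^ (n + 1 + 1 + n)) = 1 by rw [show n + 1 + 1 + n = 2 * (n + 1) by ring, pow_mul]; norm_num, one_mul,
    sub_eq_add_neg, add_comm, ← Finset.sum_neg_distrib]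
  congr 1
  refine Finset.sum_congr rfl fun i _ => ?_
  rw [show n + 1 + 1 + i = (n + 1 + i) + 1 by ring, pow_succ]
  ring

/-- **Ball-to-shell resummation** in any module: `α • B_n + Σ_{i<n} c_i • B_i = Σ_{j ≤ n} (α + Σ_{i ∈ [j,n)} c_i) • φ_j` (`B_i = Σ_{j ≤ i} φ_j`). [folklore] -/
private theorem shell_resum {M : Type*} [AddCommMonoid M] [Module ℂ M] (φ : ℕ → M) (α : ℂ) (c : ℕ → ℂ) (n : ℕ) :
    α • ∑ j ∈ range (n + 1), φ j + ∑ i ∈ range n, c i • ∑ j ∈ range (i + 1), φ j = ∑ j ∈ range (n + 1), (α + ∑ i ∈ Ico j n, c i) • φ j := by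
  have hswap : ∑ i ∈ range n, c i • ∑ j ∈ range (i + 1), φ j = ∑ j ∈ range n, (∑ i ∈ Ico j n, c i) • φ j := by
    simp_rw [Finset.smul_sum, Finset.sum_smul]
    exact Finset.sum_comm' fun i j => by
      simp only [Finset.mem_range, Finset.mem_Ico]
      omega
  rw [hswap, Finset.smul_sum, Finset.sum_range_succ (fun j => (α + ∑ i ∈ Ico j n, c i) • φ j), Finset.Ico_self, Finset.sum_empty, add_zero,
    Finset.sum_range_succ, add_assoc, add_comm (α • φ n), ← add_assoc, ← Finset.sum_add_distrib]
  congr 1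
  exact Finset.sum_congr rfl fun j _ => (add_smul _ _ _).symm

/-! ## §2′ Evaluation of the line monomials at `(y, 1)` -/

/-- `x^{ℓ_a}(y, 1) = y^a` (`ℓ_a = (a, −a)`). [cite: CartierCorvallis1979, §IV (4.2)] -/
private theorem ev_single_line (y : ℂˣ) (a : ℤ) :
    laurentEvalAt ![y, 1] (AddMonoidAlgebra.single (fun i : Fin 2 => a * (1 - 2 * (i : ℕ))) (1 : ℂ)) = (y : ℂ) ^ a := by
  rw [laurentEvalAt_single, one_mul, Fin.prod_univ_two]
  simp only [Matrix.cons_val_zero, Matrix.cons_val_one, Fin.val_zero, Fin.val_one, Nat.cast_zero, Nat.cast_one, mul_zero, sub_zero, mul_one,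
    Units.val_one, one_zpow]

/-- `x^{ℓ_{k+1}}(y, 1) = y^{k+1}`. [folklore] -/
private theorem ev_single_line_succ (y : ℂˣ) (k : ℕ) :
    laurentEvalAt ![y, 1] (AddMonoidAlgebra.single (fun i : Fin 2 => ((k : ℤ) + 1) * (1 - 2 * (i : ℕ))) (1 : ℂ)) = (y : ℂ) ^ (k + 1) := by
  rw [show ((k : ℤ) + 1) = ((k + 1 : ℕ) : ℤ) by push_cast; ring, ev_single_line, zpow_natCast]

/-- `x^{ℓ_{−(k+1)}}(y, 1) = (y⁻¹)^{k+1}`. [folklore] -/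
private theorem ev_single_line_neg_succ (y : ℂˣ) (k : ℕ) :
    laurentEvalAt ![y, 1] (AddMonoidAlgebra.single (fun i : Fin 2 => (-((k : ℤ) + 1)) * (1 - 2 * (i : ℕ))) (1 : ℂ)) = (y : ℂ)⁻¹ ^ (k + 1) := by
  rw [show ((k : ℤ) + 1) = ((k + 1 : ℕ) : ℤ) by push_cast; ring, ev_single_line, zpow_neg, zpow_natCast, inv_pow]

/-! ## §3 The `GL₂` eigenvalues `x_a = λ^{wt}_{(z,z⁻¹)}(c_{(a,0)})`: initial values and the Pieri recursion -/

section GLside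

variable {K : Type u} [Field K] [ValuativeRel K] [IsDiscreteValuationRing 𝒪[K]] [Finite 𝓀[K]] {ϖ : K}
  [IsHeckeTriple (⊤ : Submonoid (GL (Fin 2) K)) (glInt 2 K) (glInt 2 K)]
  (hϖ : IsUniformizingElement ϖ) {u : ℂˣ} (hu : (u : ℂ) ^ 2 = ((Nat.card 𝓀[K] : ℕ) : ℂ))
  {wt : Multiplicative (Fin 2 → ℤ) →* ℂ}
  (hwt : ∀ e : Fin 2 → ℤ, wt (Multiplicative.ofAdd e) = ((u ^ ((((2 : ℕ) : ℤ) - 1) * (∑ i, e i) - 2 * satakeTwistExp e) : ℂˣ) : ℂ))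

omit [Finite 𝓀[K]] in
/-- `x₀ = λ(c_0) = 1`. [folklore] -/
theorem glHeckeEigencharacter_etaLine_zpowDiagGL_zero (z : ℂˣ) :
    (isIwasawaExponent_gl hϖ).heckeEigencharacter wt (laurentMonomialHom ![z, z⁻¹])
        (heckeAlgebra.doubleCosetOperator (glInt 2 K) (zpowDiagGL hϖ.ne_zero ![((0 : ℕ) : ℤ), 0])) = 1 := by
  rw [show (![((0 : ℕ) : ℤ), 0] : Fin 2 → ℤ) = 0 from by funext i; fin_cases i <;> rfl, doubleCosetOperator_zpowDiagGL_zero_two hϖ, map_one]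

include hu hwt

/-- `x₁ = λ(c_{(1,0)}) = λ(T₁) = u (z + z⁻¹)`. [cite: ShimuraIATAF1971, Thm. 3.21] -/
theorem glHeckeEigencharacter_etaLine_zpowDiagGL_one (z : ℂˣ) :
    (isIwasawaExponent_gl hϖ).heckeEigencharacter wt (laurentMonomialHom ![z, z⁻¹])
        (heckeAlgebra.doubleCosetOperator (glInt 2 K) (zpowDiagGL hϖ.ne_zero ![((1 : ℕ) : ℤ), 0])) = (u : ℂ) * ((z : ℂ) + (z : ℂ)⁻¹) := by
  rw [Nat.cast_one, ← heckeDiag_two_one_eq_zpowDiagGL hϖ, glHeckeEigencharacter_etaLine_heckeDiag_one hϖ hu hwt]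

/-- **THE `GL₂` EIGENVALUE RECURSION ON THE LINE `(z, z⁻¹)`**: `x_{a+2} = u(z + z⁻¹)·x_{a+1} − (q_K + [a = 0])·x_a` (★ FILE A Pieri `r = 1` through `λ^{wt}`, the central
operator `T₂ ↦ 1`). [cite: Macdonald1995, Ch. V (2.6)] [cite: ShimuraIATAF1971, Thm. 3.21, 3.24] -/
theorem glHeckeEigencharacter_etaLine_zpowDiagGL_rec (z : ℂˣ) (a : ℕ) :
    (isIwasawaExponent_gl hϖ).heckeEigencharacter wt (laurentMonomialHom ![z, z⁻¹])
        (heckeAlgebra.doubleCosetOperator (glInt 2 K) (zpowDiagGL hϖ.ne_zero ![((a + 2 : ℕ) : ℤ), 0])) =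
      (u : ℂ) * ((z : ℂ) + (z : ℂ)⁻¹) *
          (isIwasawaExponent_gl hϖ).heckeEigencharacter wt (laurentMonomialHom ![z, z⁻¹])
            (heckeAlgebra.doubleCosetOperator (glInt 2 K) (zpowDiagGL hϖ.ne_zero ![((a + 1 : ℕ) : ℤ), 0])) -
        ((Nat.card 𝓀[K] + (if a + 1 = 1 then 1 else 0) : ℕ) : ℂ) *
          (isIwasawaExponent_gl hϖ).heckeEigencharacter wt (laurentMonomialHom ![z, z⁻¹])
            (heckeAlgebra.doubleCosetOperator (glInt 2 K) (zpowDiagGL hϖ.ne_zero ![((a : ℕ) : ℤ), 0])) := by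
  have h := algHom_mul_of_eq_add_smul' ((isIwasawaExponent_gl hϖ).heckeEigencharacter wt (laurentMonomialHom ![z, z⁻¹]))
    (doubleCosetOperator_zpowDiagGL_mul_heckeDiag_one_two (k := ℂ) hϖ (a := a + 1) (by omega))
  have hc := algHom_apply_eq_of_eq_mul_of_map_eq_one' ((isIwasawaExponent_gl hϖ).heckeEigencharacter wt (laurentMonomialHom ![z, z⁻¹]))
    (doubleCosetOperator_zpowDiagGL_pair_one_two (k := ℂ) hϖ (a := a + 1) (by omega)) (glHeckeEigencharacter_etaLine_heckeDiag_two hϖ hu hwt z)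
  have e : (![((a + 1 : ℕ) : ℤ) + 1, 0] : Fin 2 → ℤ) = ![((a + 2 : ℕ) : ℤ), 0] := by
    funext i
    fin_cases i
    · simp only [Fin.zero_eta, Fin.isValue, Matrix.cons_val_zero]
      push_cast
      ring
    · rfl
  simp only [glHeckeEigencharacter_etaLine_heckeDiag_one hϖ hu hwt z, hc, Nat.add_sub_cancel, e, smul_eq_mul] at h
  linear_combination -h

end GLside

/-! ## §4 (J.4) The closed form -/

section Partner

variable {F E : Type} [Field F] [NumberField F] [Field E] [NumberField E] [Algebra F E] [Algebra.IsQuadraticExtension F E]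
  (c : E ≃ₐ[F] E) (hc1 : c ≠ 1) (v : HeightOneSpectrum (𝓞 F)) (w : PlacesOver E v) (hw : c • w.1 = w.1)
  (hv : Algebra.IsUnramifiedIn (𝓞 E) v.asIdeal)
  {K : Type u} [Field K] [ValuativeRel K] [IsDiscreteValuationRing 𝒪[K]] [Finite 𝓀[K]] {ϖ : K}
  [IsHeckeTriple (⊤ : Submonoid (GL (Fin 2) K)) (glInt 2 K) (glInt 2 K)]
  (hϖ : IsUniformizingElement ϖ) {u : ℂˣ} (hu : (u : ℂ) ^ 2 = ((Nat.card 𝓀[K] : ℕ) : ℂ))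
  {wt : Multiplicative (Fin 2 → ℤ) →* ℂ}
  (hwt : ∀ e : Fin 2 → ℤ, wt (Multiplicative.ofAdd e) = ((u ^ ((((2 : ℕ) : ℤ) - 1) * (∑ i, e i) - 2 * satakeTwistExp e) : ℂˣ) : ℂ))

/-- **(J.4) THE CLOSED FORM OF `E_a = η̂(c_{(a,0)})` IN THE CARTAN BASIS OF `ℋ(U(J₀,2)(E_w), K₀)`** (`a ≥ 1`, `q = √Q = Nat.sqrt #𝓀[E_w]`, junction pin `huq : u = q`,
`B_i = Σ_{j ≤ i} φ′_j` the ball of radius `i`):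
**`η̂ c_{(a,0)} = φ′_a − (q − 1) • B_{a−1} + Σ_{i < a−1} ((q² − 1)(−1)^{a+i} q^{a−2−i}) • B_i`.**
Eigenvalue induction: both `λ^{wt}_{(z,z⁻¹)}(c_{(a,0)})` (§3) and the `U(2)` eigenvalue of the right side (`= q^a(z^a+z^{−a}) + (q²−1)q^{a−2}A_{a−1}(z)`, ★ F2′-U2) solve the same
two-step recursion with the same initial values; then ★ `eq_etaGraphTwoPartnerAlgHom_of_graph`. [cite: Rogawski1990, §4.11 Prop. 4.11.1 p. 58] [cite: Macdonald1971, Ch. V §3]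
[cite: CartierCorvallis1979, §IV Cor. 4.2] -/
theorem etaGraphTwoPartnerAlgHom_zpowDiagGL_pair_zero {ϖ' : w.1.adicCompletion E} (hd : UnramifiedLocalConjDatum (galAdicCompletionMap (L := E) c hw) ϖ')
    (t : ↥(unitaryGroupOfForm (galAdicCompletionMap (L := E) c hw) ((StdForm.antidiagonal 2).over (w.1.adicCompletion E))))
    (ht : (t : GL (Fin 2) (w.1.adicCompletion E)) = zpowDiagGL (uniformizer_ne_zero hd.vϖ) ![(1 : ℤ), -1])
    (huq : (u : ℂ) = (Nat.sqrt (Nat.card (Valued.ResidueField (w.1.adicCompletion E))) : ℂ)) {a : ℕ} (ha : 1 ≤ a) :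
    haveI := isHeckeTriple_unitaryInt_adicCompletion c v w hw ((StdForm.antidiagonal 2).over (w.1.adicCompletion E))
    etaGraphTwoPartnerAlgHom c hc1 v w hw hv hϖ hu hwt (heckeAlgebra.doubleCosetOperator (glInt 2 K) (zpowDiagGL hϖ.ne_zero ![(a : ℤ), 0])) =
      heckeAlgebra.doubleCosetOperator (k := ℂ) (unitaryInt (galAdicCompletionMap (L := E) c hw) ((StdForm.antidiagonal 2).over (w.1.adicCompletion E))) (t ^ a) +
        (-((Nat.sqrt (Nat.card (Valued.ResidueField (w.1.adicCompletion E))) : ℂ) - 1)) • ∑ j ∈ Finset.range a, heckeAlgebra.doubleCosetOperator (k := ℂ) (unitaryInt (galAdicCompletionMap (L := E) c hw) ((StdForm.antidiagonal 2).over (w.1.adicCompletion E))) (t ^ j) +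
        ∑ i ∈ Finset.range (a - 1), (((Nat.sqrt (Nat.card (Valued.ResidueField (w.1.adicCompletion E))) : ℂ) ^ 2 - 1) * (-1) ^ (a + i) * (Nat.sqrt (Nat.card (Valued.ResidueField (w.1.adicCompletion E))) : ℂ) ^ (a - 2 - i)) • ∑ j ∈ Finset.range (i + 1), heckeAlgebra.doubleCosetOperator (k := ℂ) (unitaryInt (galAdicCompletionMap (L := E) c hw) ((StdForm.antidiagonal 2).over (w.1.adicCompletion E))) (t ^ j) := by
  haveI := isHeckeTriple_unitaryInt_adicCompletion c v w hw ((StdForm.antidiagonal 2).over (w.1.adicCompletion E))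
  haveI := finite_residueField_adicCompletion E w.1
  have hσ := exists_galAdicCompletionMap_ne c hc1 v w hw
  cases a with
  | zero => exact absurd ha (by norm_num)
  | succ n => ?_
  -- `q_K = q²` from the two pins
  have hqK : ((Nat.card 𝓀[K] : ℕ) : ℂ) = (Nat.sqrt (Nat.card (Valued.ResidueField (w.1.adicCompletion E))) : ℂ) ^ 2 := by rw [← hu, huq]
  -- (1) the Satake transforms: ★ closed form of `𝒮(φ′_{n+1})`, ★ ball formula `𝒮(B_i) = q^i V_i`, `𝒮` through the linear combination
  have hT := satakeTransform_doubleCosetOperator_pow_succ_two_eq hd hσ t ht n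
  have hBall : ∀ i : ℕ, hd.satakeTransform (∑ j ∈ Finset.range (i + 1), heckeAlgebra.doubleCosetOperator (k := ℂ) (unitaryInt (galAdicCompletionMap (L := E) c hw) ((StdForm.antidiagonal 2).over (w.1.adicCompletion E))) (t ^ j)) = ((Nat.sqrt (Nat.card (Valued.ResidueField (w.1.adicCompletion E))) : ℂ) ^ i) •
        (1 + ∑ j ∈ Finset.range i, (AddMonoidAlgebra.single (fun l : Fin 2 => ((j : ℤ) + 1) * (1 - 2 * (l : ℕ))) (1 : ℂ) +
            AddMonoidAlgebra.single (fun l : Fin 2 => (-((j : ℤ) + 1)) * (1 - 2 * (l : ℕ))) (1 : ℂ))) := fun i =>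
    (algHom_apply_sum' hd.satakeTransform _ _).trans (sum_satakeTransform_doubleCosetOperator_pow_two hd hσ t ht i)
  have hS : hd.satakeTransform
      (heckeAlgebra.doubleCosetOperator (k := ℂ) (unitaryInt (galAdicCompletionMap (L := E) c hw) ((StdForm.antidiagonal 2).over (w.1.adicCompletion E))) (t ^ (n + 1)) +
        (-((Nat.sqrt (Nat.card (Valued.ResidueField (w.1.adicCompletion E))) : ℂ) - 1)) • ∑ j ∈ Finset.range (n + 1), heckeAlgebra.doubleCosetOperator (k := ℂ) (unitaryInt (galAdicCompletionMap (L := E) c hw) ((StdForm.antidiagonal 2).over (w.1.adicCompletion E))) (t ^ j) +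
        ∑ i ∈ Finset.range (n + 1 - 1), (((Nat.sqrt (Nat.card (Valued.ResidueField (w.1.adicCompletion E))) : ℂ) ^ 2 - 1) * (-1) ^ (n + 1 + i) * (Nat.sqrt (Nat.card (Valued.ResidueField (w.1.adicCompletion E))) : ℂ) ^ (n + 1 - 2 - i)) • ∑ j ∈ Finset.range (i + 1), heckeAlgebra.doubleCosetOperator (k := ℂ) (unitaryInt (galAdicCompletionMap (L := E) c hw) ((StdForm.antidiagonal 2).over (w.1.adicCompletion E))) (t ^ j)) =
      ((Nat.sqrt (Nat.card (Valued.ResidueField (w.1.adicCompletion E))) : ℂ) ^ (n + 1)) •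
          (AddMonoidAlgebra.single (fun i : Fin 2 => ((n : ℤ) + 1) * (1 - 2 * (i : ℕ))) (1 : ℂ) +
            AddMonoidAlgebra.single (fun i : Fin 2 => (-((n : ℤ) + 1)) * (1 - 2 * (i : ℕ))) (1 : ℂ)) +
        (((Nat.sqrt (Nat.card (Valued.ResidueField (w.1.adicCompletion E))) : ℂ) - 1) * (Nat.sqrt (Nat.card (Valued.ResidueField (w.1.adicCompletion E))) : ℂ) ^ n) •
          (1 + ∑ k ∈ Finset.range n, (AddMonoidAlgebra.single (fun i : Fin 2 => ((k : ℤ) + 1) * (1 - 2 * (i : ℕ))) (1 : ℂ) +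
            AddMonoidAlgebra.single (fun i : Fin 2 => (-((k : ℤ) + 1)) * (1 - 2 * (i : ℕ))) (1 : ℂ))) +
        (-((Nat.sqrt (Nat.card (Valued.ResidueField (w.1.adicCompletion E))) : ℂ) - 1)) • (((Nat.sqrt (Nat.card (Valued.ResidueField (w.1.adicCompletion E))) : ℂ) ^ n) •
          (1 + ∑ j ∈ Finset.range n, (AddMonoidAlgebra.single (fun l : Fin 2 => ((j : ℤ) + 1) * (1 - 2 * (l : ℕ))) (1 : ℂ) +
            AddMonoidAlgebra.single (fun l : Fin 2 => (-((j : ℤ) + 1)) * (1 - 2 * (l : ℕ))) (1 : ℂ)))) +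
        ∑ i ∈ Finset.range (n + 1 - 1), (((Nat.sqrt (Nat.card (Valued.ResidueField (w.1.adicCompletion E))) : ℂ) ^ 2 - 1) * (-1) ^ (n + 1 + i) * (Nat.sqrt (Nat.card (Valued.ResidueField (w.1.adicCompletion E))) : ℂ) ^ (n + 1 - 2 - i)) • (((Nat.sqrt (Nat.card (Valued.ResidueField (w.1.adicCompletion E))) : ℂ) ^ i) •
          (1 + ∑ j ∈ Finset.range i, (AddMonoidAlgebra.single (fun l : Fin 2 => ((j : ℤ) + 1) * (1 - 2 * (l : ℕ))) (1 : ℂ) +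
            AddMonoidAlgebra.single (fun l : Fin 2 => (-((j : ℤ) + 1)) * (1 - 2 * (l : ℕ))) (1 : ℂ)))) := by
    rw [algHom_apply_add_smul_add_sum_smul hd.satakeTransform]
    simp only [hT, hBall]
  -- (2) the graph: both adic eigencharacters through the datum, both sides to the same scalar
  refine (eq_etaGraphTwoPartnerAlgHom_of_graph c hc1 v w hw hv hϖ hu hwt _ _ fun z => ?_).symm
  -- (2a) the U(2) side: `λ_{(z,1)}(RHS) = q^{n+1} P_{n+1} + (q²−1) q^{n−1} A_n`
  have hR : unitaryHeckeEigencharacterAdic c hc1 v w hw hv ![z, 1]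
      (heckeAlgebra.doubleCosetOperator (k := ℂ) (unitaryInt (galAdicCompletionMap (L := E) c hw) ((StdForm.antidiagonal 2).over (w.1.adicCompletion E))) (t ^ (n + 1)) +
        (-((Nat.sqrt (Nat.card (Valued.ResidueField (w.1.adicCompletion E))) : ℂ) - 1)) • ∑ j ∈ Finset.range (n + 1), heckeAlgebra.doubleCosetOperator (k := ℂ) (unitaryInt (galAdicCompletionMap (L := E) c hw) ((StdForm.antidiagonal 2).over (w.1.adicCompletion E))) (t ^ j) +
        ∑ i ∈ Finset.range (n + 1 - 1), (((Nat.sqrt (Nat.card (Valued.ResidueField (w.1.adicCompletion E))) : ℂ) ^ 2 - 1) * (-1) ^ (n + 1 + i) * (Nat.sqrt (Nat.card (Valued.ResidueField (w.1.adicCompletion E))) : ℂ) ^ (n + 1 - 2 - i)) • ∑ j ∈ Finset.range (i + 1), heckeAlgebra.doubleCosetOperator (k := ℂ) (unitaryInt (galAdicCompletionMap (L := E) c hw) ((StdForm.antidiagonal 2).over (w.1.adicCompletion E))) (t ^ j)) =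
      (Nat.sqrt (Nat.card (Valued.ResidueField (w.1.adicCompletion E))) : ℂ) ^ (n + 1) * ((z : ℂ) ^ (n + 1) + (z : ℂ)⁻¹ ^ (n + 1)) +
        ((Nat.sqrt (Nat.card (Valued.ResidueField (w.1.adicCompletion E))) : ℂ) ^ 2 - 1) * (Nat.sqrt (Nat.card (Valued.ResidueField (w.1.adicCompletion E))) : ℂ) ^ (n - 1) * ∑ i ∈ Finset.range n, (-1 : ℂ) ^ (n + 1 + i) * (1 + ∑ k ∈ Finset.range i, ((z : ℂ) ^ (k + 1) + (z : ℂ)⁻¹ ^ (k + 1))) := by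
    refine (DFunLike.congr_fun (unitaryHeckeEigencharacterAdic_eq c hc1 v w hw hv hd ![z, 1]) _).trans
      (((hd.heckeEigencharacter_apply ![z, 1] _).trans (congrArg (laurentEvalAt ![z, 1]) hS)).trans ?_)
    simp only [map_add, map_smul, map_sum, map_one, ev_single_line_succ, ev_single_line_neg_succ, smul_eq_mul, Nat.add_sub_cancel]
    have hsum : (∑ i ∈ Finset.range n, (((Nat.sqrt (Nat.card (Valued.ResidueField (w.1.adicCompletion E))) : ℂ) ^ 2 - 1) * (-1) ^ (n + 1 + i) * (Nat.sqrt (Nat.card (Valued.ResidueField (w.1.adicCompletion E))) : ℂ) ^ (n + 1 - 2 - i)) * ((Nat.sqrt (Nat.card (Valued.ResidueField (w.1.adicCompletion E))) : ℂ) ^ i * (1 + ∑ k ∈ Finset.range i, ((z : ℂ) ^ (k + 1) + (z : ℂ)⁻¹ ^ (k + 1))))) =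
        ((Nat.sqrt (Nat.card (Valued.ResidueField (w.1.adicCompletion E))) : ℂ) ^ 2 - 1) * (Nat.sqrt (Nat.card (Valued.ResidueField (w.1.adicCompletion E))) : ℂ) ^ (n - 1) * ∑ i ∈ Finset.range n, (-1 : ℂ) ^ (n + 1 + i) * (1 + ∑ k ∈ Finset.range i, ((z : ℂ) ^ (k + 1) + (z : ℂ)⁻¹ ^ (k + 1))) := by
      rw [Finset.mul_sum]
      refine Finset.sum_congr rfl fun i hi => ?_
      have hi' := Finset.mem_range.1 hi
      rw [show n + 1 - 2 - i = n - 1 - i by omega, ← pow_sub_mul_pow (Nat.sqrt (Nat.card (Valued.ResidueField (w.1.adicCompletion E))) : ℂ) (show i ≤ n - 1 by omega)]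
      ring
    rw [hsum]
    ring
  refine Eq.trans ?_ hR.symm
  -- (2b) the GL₂ side equals the same scalar: two-step recursion uniqueness (§1, §3)
  have hA := cheb_alt ((z : ℂ) + (z : ℂ)⁻¹) (fun i => (1 + ∑ k ∈ Finset.range i, ((z : ℂ) ^ (k + 1) + (z : ℂ)⁻¹ ^ (k + 1)))) (fun m => ∑ i ∈ Finset.range m, (-1 : ℂ) ^ (m + 1 + i) * (1 + ∑ k ∈ Finset.range i, ((z : ℂ) ^ (k + 1) + (z : ℂ)⁻¹ ^ (k + 1))))
    (by simp) (fun m => alt_succ _ m) (fun m => ball_cheb z m) (by simp)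
  have hx := etaTwo_twoStepRec_unique
    (fun b => (isIwasawaExponent_gl hϖ).heckeEigencharacter wt (laurentMonomialHom ![z, z⁻¹])
      (heckeAlgebra.doubleCosetOperator (glInt 2 K) (zpowDiagGL hϖ.ne_zero ![((b : ℕ) : ℤ), 0])))
    (fun b => if b = 0 then 1 else (Nat.sqrt (Nat.card (Valued.ResidueField (w.1.adicCompletion E))) : ℂ) ^ b * ((z : ℂ) ^ b + (z : ℂ)⁻¹ ^ b) + ((Nat.sqrt (Nat.card (Valued.ResidueField (w.1.adicCompletion E))) : ℂ) ^ 2 - 1) * (Nat.sqrt (Nat.card (Valued.ResidueField (w.1.adicCompletion E))) : ℂ) ^ (b - 2) * ∑ i ∈ Finset.range (b - 1), (-1 : ℂ) ^ (b + i) * (1 + ∑ k ∈ Finset.range i, ((z : ℂ) ^ (k + 1) + (z : ℂ)⁻¹ ^ (k + 1))))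
    (fun _ => (Nat.sqrt (Nat.card (Valued.ResidueField (w.1.adicCompletion E))) : ℂ) * ((z : ℂ) + (z : ℂ)⁻¹))
    (fun b => ((Nat.card 𝓀[K] + (if b + 1 = 1 then 1 else 0) : ℕ) : ℂ))
    (by rw [if_pos rfl]; exact glHeckeEigencharacter_etaLine_zpowDiagGL_zero hϖ z)
    (by rw [if_neg one_ne_zero, glHeckeEigencharacter_etaLine_zpowDiagGL_one hϖ hu hwt z, huq]; simp)
    (fun b => by rw [glHeckeEigencharacter_etaLine_zpowDiagGL_rec hϖ hu hwt z b, huq])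
    (fun b => by
      rcases b with _ | _ | k
      · -- `y₂ = q s·y₁ − (q²+1)·y₀`
        have h := closedForm_rec_one ((z : ℂ) + (z : ℂ)⁻¹) (Nat.sqrt (Nat.card (Valued.ResidueField (w.1.adicCompletion E))) : ℂ) (fun b => ((z : ℂ) ^ b + (z : ℂ)⁻¹ ^ b)) (fun m => ∑ i ∈ Finset.range m, (-1 : ℂ) ^ (m + 1 + i) * (1 + ∑ k ∈ Finset.range i, ((z : ℂ) ^ (k + 1) + (z : ℂ)⁻¹ ^ (k + 1))))
          (fun b => orbit_cheb z b) (by norm_num) (by simp) (by simp)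
        rw [if_neg (show (0 : ℕ) + 2 ≠ 0 by omega), if_neg (show (0 : ℕ) + 1 ≠ 0 by omega), if_pos (show (0 : ℕ) = 0 from rfl),
          if_pos (show (0 : ℕ) + 1 = 1 from rfl)]
        simp only [show (0 : ℕ) + 2 = 2 from rfl, show (0 : ℕ) + 1 = 1 from rfl, show (2 : ℕ) - 2 = 0 from rfl, show (2 : ℕ) - 1 = 1 from rfl,
          pow_zero, pow_one, mul_one, Finset.sum_range_zero, Finset.sum_range_one, mul_zero, add_zero, Nat.cast_add, Nat.cast_one, hqK] at h ⊢
        linear_combination h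
      · -- `y₃ = q s·y₂ − q²·y₁`
        have h := closedForm_rec_two ((z : ℂ) + (z : ℂ)⁻¹) (Nat.sqrt (Nat.card (Valued.ResidueField (w.1.adicCompletion E))) : ℂ) (fun b => ((z : ℂ) ^ b + (z : ℂ)⁻¹ ^ b)) (fun m => ∑ i ∈ Finset.range m, (-1 : ℂ) ^ (m + 1 + i) * (1 + ∑ k ∈ Finset.range i, ((z : ℂ) ^ (k + 1) + (z : ℂ)⁻¹ ^ (k + 1))))
          (fun b => orbit_cheb z b) (by simp) hA
        rw [if_neg (show (0 : ℕ) + 1 + 2 ≠ 0 by omega), if_neg (show (0 : ℕ) + 1 + 1 ≠ 0 by omega), if_neg (show (0 : ℕ) + 1 ≠ 0 by omega),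
          if_neg (show (0 : ℕ) + 1 + 1 ≠ 1 by omega)]
        simp only [show (0 : ℕ) + 1 + 2 = 3 from rfl, show (0 : ℕ) + 1 + 1 = 2 from rfl, show (0 : ℕ) + 1 = 1 from rfl, show (3 : ℕ) - 2 = 1 from rfl,
          show (3 : ℕ) - 1 = 2 from rfl, show (2 : ℕ) - 2 = 0 from rfl, pow_zero, pow_one, mul_one, Finset.sum_range_zero, Finset.sum_range_succ, mul_zero,
          add_zero, zero_add, hqK] at h ⊢
        linear_combination h
      · -- `y_{k+4} = q s·y_{k+3} − q²·y_{k+2}`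
        have h := closedForm_rec_succ ((z : ℂ) + (z : ℂ)⁻¹) (Nat.sqrt (Nat.card (Valued.ResidueField (w.1.adicCompletion E))) : ℂ) (fun b => ((z : ℂ) ^ b + (z : ℂ)⁻¹ ^ b)) (fun m => ∑ i ∈ Finset.range m, (-1 : ℂ) ^ (m + 1 + i) * (1 + ∑ k ∈ Finset.range i, ((z : ℂ) ^ (k + 1) + (z : ℂ)⁻¹ ^ (k + 1))))
          (fun b => orbit_cheb z b) hA k
        simp only [show k + 1 + 1 + 2 = k + 4 by omega, show k + 1 + 1 + 1 = k + 3 by omega, show k + 1 + 1 = k + 2 by omega]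
        rw [if_neg (show k + 4 ≠ 0 by omega), if_neg (show k + 3 ≠ 0 by omega), if_neg (show k + 2 ≠ 0 by omega), if_neg (show k + 3 ≠ 1 by omega)]
        simp only [show k + 4 - 2 = k + 2 by omega, show k + 4 - 1 = k + 3 by omega, show k + 3 - 2 = k + 1 by omega, show k + 3 - 1 = k + 2 by omega,
          show k + 2 - 2 = k by omega, show k + 2 - 1 = k + 1 by omega, show k + 3 + 1 = k + 4 by omega, show k + 2 + 1 = k + 3 by omega,
          show k + 1 + 1 = k + 2 by omega, add_zero, hqK] at h ⊢
        linear_combination h)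
    (n + 1)
  refine hx.trans ?_
  rw [if_neg (show n + 1 ≠ 0 by omega), show n + 1 - 2 = n - 1 by omega, Nat.add_sub_cancel]

/-- **(J.4′) THE SHELL FORM** (`a ≥ 1`): **`η̂ c_{(a,0)} = φ′_a + Σ_{j<a} e_{a,j} • φ′_j`, `e_{a,j} = −(q−1) + (q²−1) Σ_{i ∈ [j, a−1)} (−1)^{a+i} q^{a−2−i}`** —
(J.4) resummed ball-by-shell (`B_i = Σ_{j ≤ i} φ′_j`); the coefficients E1.4.4.3.2's count side reads (`e_{a,a−1} = −(q−1)`, `e_{a,a−2} = −(q−1) + (q²−1) = q² − q`,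
`e_{a,a−3} = −(q−1) − (q²−1)(q − 1)`, …). [cite: Rogawski1990, §4.11 Prop. 4.11.1 p. 58] [cite: Macdonald1971, Ch. V §3] -/
theorem etaGraphTwoPartnerAlgHom_zpowDiagGL_pair_zero_shell {ϖ' : w.1.adicCompletion E} (hd : UnramifiedLocalConjDatum (galAdicCompletionMap (L := E) c hw) ϖ')
    (t : ↥(unitaryGroupOfForm (galAdicCompletionMap (L := E) c hw) ((StdForm.antidiagonal 2).over (w.1.adicCompletion E))))
    (ht : (t : GL (Fin 2) (w.1.adicCompletion E)) = zpowDiagGL (uniformizer_ne_zero hd.vϖ) ![(1 : ℤ), -1])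
    (huq : (u : ℂ) = (Nat.sqrt (Nat.card (Valued.ResidueField (w.1.adicCompletion E))) : ℂ)) {a : ℕ} (ha : 1 ≤ a) :
    haveI := isHeckeTriple_unitaryInt_adicCompletion c v w hw ((StdForm.antidiagonal 2).over (w.1.adicCompletion E))
    etaGraphTwoPartnerAlgHom c hc1 v w hw hv hϖ hu hwt (heckeAlgebra.doubleCosetOperator (glInt 2 K) (zpowDiagGL hϖ.ne_zero ![(a : ℤ), 0])) =
      heckeAlgebra.doubleCosetOperator (k := ℂ) (unitaryInt (galAdicCompletionMap (L := E) c hw) ((StdForm.antidiagonal 2).over (w.1.adicCompletion E))) (t ^ a) +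
        ∑ j ∈ Finset.range a,
          (-((Nat.sqrt (Nat.card (Valued.ResidueField (w.1.adicCompletion E))) : ℂ) - 1) + ∑ i ∈ Finset.Ico j (a - 1), ((Nat.sqrt (Nat.card (Valued.ResidueField (w.1.adicCompletion E))) : ℂ) ^ 2 - 1) * (-1) ^ (a + i) * (Nat.sqrt (Nat.card (Valued.ResidueField (w.1.adicCompletion E))) : ℂ) ^ (a - 2 - i)) • heckeAlgebra.doubleCosetOperator (k := ℂ) (unitaryInt (galAdicCompletionMap (L := E) c hw) ((StdForm.antidiagonal 2).over (w.1.adicCompletion E))) (t ^ j) := by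
  haveI := isHeckeTriple_unitaryInt_adicCompletion c v w hw ((StdForm.antidiagonal 2).over (w.1.adicCompletion E))
  refine (etaGraphTwoPartnerAlgHom_zpowDiagGL_pair_zero c hc1 v w hw hv hϖ hu hwt hd t ht huq ha).trans ?_
  cases a with
  | zero => exact absurd ha (by norm_num)
  | succ n =>
    -- `n + 1 - 1` is definitionally `n`: no rewriting on the heavy carrier
    exact (add_assoc _ _ _).trans (congrArg (_ + ·) (shell_resum (fun j => heckeAlgebra.doubleCosetOperator (k := ℂ) (unitaryInt (galAdicCompletionMap (L := E) c hw) ((StdForm.antidiagonal 2).over (w.1.adicCompletion E))) (t ^ j)) _ _ n))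

end Partner

end Summit.HodgeConjecture.HodgeConjecture.R90.S6

end
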